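import Summits.QuantumFields.YangMills.Theorems.VirialFluxGapAnchorSliceAlgebra
import Summits.QuantumFields.YangMills.Theorems.VirialFluxGapAnchorChartDefs
import HarnessLib

/-!
# The two-anchor window map: SMOOTHNESS (and the base point)
# (layer (B2) of the DIRECT Laplace road to ⟨stmt-QuantumFields-24204⟩ `VirialFluxGap.SharpTwistedLaplace`)

Helper module (free-hands work of width seat ym-line-sfw-p2-w3 g57, cell ym-idea-1; `--supports 24204`).  For the window map
`Θ'(z, a) = (k·seamSlice(a₀)·k⁻¹, k·linkSlice(a₁,a₂)·k⁻¹)`, `k = expPoint z` (✓`VirialFluxGapAnchorChartDefs.anchorMap`) and its reading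
`anchorCoord` in the exponential coordinates of `SU2 × SU2` (✓`T4ExpWindowSmallField.logVec`):
* §1 `contDiffAt_logVec` — the chart logarithm `logVec` is `C^∞` away from the poles (`im q ≠ 0`, `re q ≠ ±1`; it is
  `(arccos re q / ‖im q‖)·im q` there); `contDiffAt_anchorCoord` — ★ `anchorCoord` is `C^∞` on the window `‖a‖ < 1` (the two anchors
  have real parts `−sin a₀` and `∓ sinc‖b‖·a₁`, of modulus `< 1`);
* §2 the base point: `anchorMap 0 = (C₀, N₀)`, `anchorCoord 0 = ((π/2)ω_C, logVec(su2Quat N₀))`;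
* (sequel `VirialFluxGapAnchorChartTransversal`: `ker D(anchorCoord)(0) = 0`, non-zero Jacobian at the base point).
These are the `C¹` inputs of Mathlib's change of variables (`MeasureTheory.map_withDensity_abs_det_fderiv_eq_addHaar`) for the
6-dimensional anchor core of the slice-chart identity `hloc` of ✓`QuantitativeLaplace.laplaceMethod_quantitative_orbit_tube` on `X_fix`.
Everything here is PROVED; no definitions, no named facts (namespace `Summit.QuantumFields.YangMills.Theorems.VirialFluxGap.AnchorSlice`).
HONEST FRAMING: finite-dimensional calculus; ⟨24204⟩, ⟨24319⟩ and every rung stay OPEN; the Yang–Mills mass gap (Clay) is NOT touched; no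
summit is proved by a line.

## References
* G. E. Bredon, *Introduction to Compact Transformation Groups* (1972), Ch. II §§4–5 (slices, tubes). [Bredon1972]
* K. W. Breitung, *Asymptotic Approximations for Probability Integrals*, LNM 1592 (1994), §2.3 Definitions 4–5. [Breitung1994]
-/

set_option autoImplicit false

noncomputable section

open scoped Quaternion RealInnerProductSpace
open NormedSpace MeasureTheory Set Filter Topology
open Literature.MathematicalPhysics.QuantumLattice
open Literature.MathematicalPhysics.QuantumFieldTheory.Balaban1983to89
open Literature.MathematicalPhysics.QuantumFieldTheory.Balaban1983to89.T4HaarSU2ExpChart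
open Literature.MathematicalPhysics.QuantumFieldTheory.Balaban1983to89.T4ExpWindowSmallField
open Literature.MathematicalPhysics.QuantumFieldTheory.Balaban1983to89.B15Prop1ChartCalculusSU2
open Literature.MathematicalPhysics.QuantumFieldTheory.Balaban1983to89.T4WilsonGaugeFlatDirection (su2Quat_injective)
open Literature.MathematicalPhysics.QuantumFieldTheory.Balaban1983to89.T4WilsonLinkAffine (su2Quat_inv)
open Literature.MathematicalPhysics.QuantumFieldTheory.Balaban1983to89.T4HaarSU2Translate (su2Quat_mul su2Quat_one)
open Summit.QuantumFields.YangMills.Theorems.FemtoTransferGap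

namespace Summit.QuantumFields.YangMills.Theorems.VirialFluxGap.AnchorSlice


/-! ## §1 Smoothness -/

/-- `exp` is smooth on `ℍ`. [folklore] -/
theorem contDiff_exp_quat {n : WithTop ℕ∞} : ContDiff ℝ n (fun q : ℍ => exp q) :=
  contDiff_iff_contDiffAt.2 fun x => (NormedSpace.exp_analytic x).contDiffAt

/-- `z ↦ exp(ι z)` is smooth. [folklore] -/
theorem contDiff_exp_imQuat {n : WithTop ℕ∞} : ContDiff ℝ n (fun z : EuclideanSpace ℝ (Fin 3) => exp (imQuat z)) :=
  contDiff_exp_quat.comp imQuatL.contDiff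

/-- `q ↦ re q` is smooth. [folklore] -/
theorem contDiff_quat_re {n : WithTop ℕ∞} : ContDiff ℝ n (fun q : ℍ => q.re) :=
  (LinearMap.toContinuousLinearMap
    ({ toFun := fun q : ℍ => q.re, map_add' := fun a b => by simp, map_smul' := fun c a => by simp } : ℍ →ₗ[ℝ] ℝ)).contDiff

/-- `star` on `ℍ` is smooth (a real-linear map). [folklore] -/
theorem contDiff_quat_star {n : WithTop ℕ∞} : ContDiff ℝ n (fun q : ℍ => star q) :=
  (LinearMap.toContinuousLinearMap
    ({ toFun := fun q : ℍ => star q, map_add' := fun a b => star_add a b,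
       map_smul' := fun c a => Quaternion.star_smul c a } : ℍ →ₗ[ℝ] ℍ)).contDiff

/-- **`logVec` is smooth away from the poles** (`im q ≠ 0`, `re q ≠ ±1`). [folklore] -/
theorem contDiffAt_logVec {q : ℍ} (him : imVec q ≠ 0) (h1 : q.re ≠ -1) (h2 : q.re ≠ 1) {n : WithTop ℕ∞} :
    ContDiffAt ℝ n logVec q := by
  have hev : (fun p : ℍ => (Real.arccos p.re / ‖imVec p‖) • imVec p) =ᶠ[𝓝 q] logVec := by
    have hopen : IsOpen {p : ℍ | imVec p ≠ 0} := isOpen_ne_fun imVecL.continuous continuous_const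
    filter_upwards [hopen.mem_nhds him] with p hp
    rw [logVec, if_neg hp]
  refine ContDiffAt.congr_of_eventuallyEq ?_ hev.symm
  have h1' : ContDiffAt ℝ n (fun p : ℍ => Real.arccos p.re) q :=
    (Real.contDiffAt_arccos h1 h2).comp q contDiff_quat_re.contDiffAt
  have h2' : ContDiffAt ℝ n (fun p : ℍ => ‖imVec p‖) q :=
    (contDiffAt_norm ℝ him).comp q imVecL.contDiff.contDiffAt
  exact (h1'.div h2' (norm_ne_zero_iff.2 him)).smul imVecL.contDiff.contDiffAt

/-- For a unit quaternion with `|re q| < 1`: `im q ≠ 0`. [folklore] -/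
theorem imVec_ne_zero_of_abs_re_lt_one {q : ℍ} (hq : ‖q‖ = 1) (hre : |q.re| < 1) : imVec q ≠ 0 := by
  intro h
  have h1 := norm_imVec_sq_of_norm_eq_one hq
  rw [h, norm_zero] at h1
  have : q.re ^ 2 < 1 := by
    have := abs_lt.mp hre
    nlinarith
  nlinarith

/-- `logVec` is smooth at unit quaternions with `|re q| < 1`. [folklore] -/
theorem contDiffAt_logVec_of_unit {q : ℍ} (hq : ‖q‖ = 1) (hre : |q.re| < 1) {n : WithTop ℕ∞} :
    ContDiffAt ℝ n logVec q :=
  contDiffAt_logVec (imVec_ne_zero_of_abs_re_lt_one hq hre) (by intro h; rw [h] at hre; norm_num at hre)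
    (by intro h; rw [h] at hre; norm_num at hre)

section Anchors

variable {ωC ωN ωX : EuclideanSpace ℝ (Fin 3)} {C₀ N₀ : SU2}

/-- The seam anchor as a quaternion: `su2Quat (k·seamSlice(t)·k⁻¹) = e^{ιz} (e^{ι(tω_C)} ιω_C) (e^{ιz})*`. [folklore] -/
theorem su2Quat_anchorMap_fst (hC₀ : su2Quat C₀ = imQuat ωC) (w : EuclideanSpace ℝ (Fin 3) × EuclideanSpace ℝ (Fin 3)) :
    su2Quat (anchorMap ωC ωN ωX C₀ N₀ w).1 =
      exp (imQuat w.1) * (exp (imQuat ((w.2 0) • ωC)) * imQuat ωC) * star (exp (imQuat w.1)) := by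
  simp only [anchorMap, seamSlice, su2Quat_mul, su2Quat_inv, su2Quat_expPoint, hC₀, mul_assoc]

/-- The link anchor as a quaternion. [folklore] -/
theorem su2Quat_anchorMap_snd (w : EuclideanSpace ℝ (Fin 3) × EuclideanSpace ℝ (Fin 3)) :
    su2Quat (anchorMap ωC ωN ωX C₀ N₀ w).2 =
      exp (imQuat w.1) * (exp (imQuat ((w.2 1) • ωN + (w.2 2) • ωX)) * su2Quat N₀) * star (exp (imQuat w.1)) := by
  simp only [anchorMap, linkSlice, su2Quat_mul, su2Quat_inv, su2Quat_expPoint, mul_assoc]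

/-- Smoothness of the seam-anchor quaternion map. [folklore] -/
theorem contDiff_anchor_fst_quat {n : WithTop ℕ∞} :
    ContDiff ℝ n (fun w : EuclideanSpace ℝ (Fin 3) × EuclideanSpace ℝ (Fin 3) =>
      exp (imQuat w.1) * (exp (imQuat ((w.2 0) • ωC)) * imQuat ωC) * star (exp (imQuat w.1))) := by
  have h1 : ContDiff ℝ n (fun w : EuclideanSpace ℝ (Fin 3) × EuclideanSpace ℝ (Fin 3) => exp (imQuat w.1)) :=
    contDiff_exp_imQuat.comp contDiff_fst
  have h0 : ContDiff ℝ n (fun w : EuclideanSpace ℝ (Fin 3) × EuclideanSpace ℝ (Fin 3) => w.2 0) :=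
    (EuclideanSpace.proj (0 : Fin 3) : EuclideanSpace ℝ (Fin 3) →L[ℝ] ℝ).contDiff.comp contDiff_snd
  have h2 : ContDiff ℝ n (fun w : EuclideanSpace ℝ (Fin 3) × EuclideanSpace ℝ (Fin 3) => exp (imQuat ((w.2 0) • ωC))) :=
    contDiff_exp_imQuat.comp (h0.smul contDiff_const)
  have h3 : ContDiff ℝ n (fun w : EuclideanSpace ℝ (Fin 3) × EuclideanSpace ℝ (Fin 3) => star (exp (imQuat w.1))) :=
    contDiff_quat_star.comp h1
  exact (h1.mul (h2.mul contDiff_const)).mul h3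

/-- Smoothness of the link-anchor quaternion map. [folklore] -/
theorem contDiff_anchor_snd_quat {n : WithTop ℕ∞} :
    ContDiff ℝ n (fun w : EuclideanSpace ℝ (Fin 3) × EuclideanSpace ℝ (Fin 3) =>
      exp (imQuat w.1) * (exp (imQuat ((w.2 1) • ωN + (w.2 2) • ωX)) * su2Quat N₀) * star (exp (imQuat w.1))) := by
  have h1 : ContDiff ℝ n (fun w : EuclideanSpace ℝ (Fin 3) × EuclideanSpace ℝ (Fin 3) => exp (imQuat w.1)) :=
    contDiff_exp_imQuat.comp contDiff_fst
  have hc : ∀ i : Fin 3, ContDiff ℝ n (fun w : EuclideanSpace ℝ (Fin 3) × EuclideanSpace ℝ (Fin 3) => w.2 i) := fun i =>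
    (EuclideanSpace.proj i : EuclideanSpace ℝ (Fin 3) →L[ℝ] ℝ).contDiff.comp contDiff_snd
  have h2 : ContDiff ℝ n (fun w : EuclideanSpace ℝ (Fin 3) × EuclideanSpace ℝ (Fin 3) =>
      exp (imQuat ((w.2 1) • ωN + (w.2 2) • ωX))) :=
    contDiff_exp_imQuat.comp (((hc 1).smul contDiff_const).add ((hc 2).smul contDiff_const))
  have h3 : ContDiff ℝ n (fun w : EuclideanSpace ℝ (Fin 3) × EuclideanSpace ℝ (Fin 3) => star (exp (imQuat w.1))) :=
    contDiff_quat_star.comp h1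
  exact (h1.mul (h2.mul contDiff_const)).mul h3

/-- Real part of a conjugate: `re (k x k*) = re x` for a unit quaternion `k`. [folklore] -/
theorem re_conj_unit {k : ℍ} (hk : ‖k‖ = 1) (x : ℍ) : (k * x * star k).re = x.re := by
  have hkk : star k * k = 1 := by
    rw [Quaternion.star_mul_self k, Quaternion.normSq_eq_norm_mul_self, hk]; norm_num
  rw [show (k * x * star k).re = (star k * (k * x)).re by simp only [Quaternion.re_mul]; ring, ← mul_assoc, hkk, one_mul]

/-- The real part of the seam anchor: `re = −sin a₀`. [folklore] -/
theorem re_anchor_fst (hC : ‖ωC‖ = 1) (hC₀ : su2Quat C₀ = imQuat ωC) (w : EuclideanSpace ℝ (Fin 3) × EuclideanSpace ℝ (Fin 3)) :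
    (su2Quat (anchorMap ωC ωN ωX C₀ N₀ w).1).re = -Real.sin (w.2 0) := by
  rw [su2Quat_anchorMap_fst hC₀, re_conj_unit (norm_exp_imQuat w.1), exp_smul_mul_self hC]
  simp [imQuat_re]

/-- The real part of the link anchor: `re = ∓ sinc‖b‖ · b₁` (`b = a₁ω_N + a₂ω_×`). [folklore] -/
theorem re_anchor_snd (hC : ‖ωC‖ = 1) (hN : ‖ωN‖ = 1) (hCN : ⟪ωC, ωN⟫ = 0) (hX : imQuat ωX = imQuat ωC * imQuat ωN)
    (hN₀ : su2Quat N₀ = imQuat ωN ∨ su2Quat N₀ = -imQuat ωN) (w : EuclideanSpace ℝ (Fin 3) × EuclideanSpace ℝ (Fin 3)) :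
    |(su2Quat (anchorMap ωC ωN ωX C₀ N₀ w).2).re| = |Real.sinc ‖(w.2 1) • ωN + (w.2 2) • ωX‖ * (w.2 1)| := by
  rw [su2Quat_anchorMap_snd, re_conj_unit (norm_exp_imQuat w.1)]
  rcases hN₀ with h | h
  · rw [h, exp_perp_mul_anchor hC hN hCN hX]
    simp [imQuat_re]
  · rw [h, mul_neg, Quaternion.re_neg, exp_perp_mul_anchor hC hN hCN hX, abs_neg]
    simp [imQuat_re]

/-- ★ **`anchorCoord` is smooth on the window `‖a‖ < 1`** (any group coordinate `z`). [folklore] -/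
theorem contDiffAt_anchorCoord (hC : ‖ωC‖ = 1) (hN : ‖ωN‖ = 1) (hCN : ⟪ωC, ωN⟫ = 0) (hX : imQuat ωX = imQuat ωC * imQuat ωN)
    (hC₀ : su2Quat C₀ = imQuat ωC) (hN₀ : su2Quat N₀ = imQuat ωN ∨ su2Quat N₀ = -imQuat ωN) {n : WithTop ℕ∞}
    {w : EuclideanSpace ℝ (Fin 3) × EuclideanSpace ℝ (Fin 3)} (hw : ‖w.2‖ < 1) :
    ContDiffAt ℝ n (anchorCoord ωC ωN ωX C₀ N₀) w := by
  have hX1 : ‖ωX‖ = 1 := by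
    rw [← norm_imQuat, hX, norm_mul, norm_imQuat, norm_imQuat, hC, hN, mul_one]
  have hNX : ⟪ωN, ωX⟫ = 0 := by
    have h := inner_pure_mul_right (imQuat_re ωC) (imQuat_re ωN)
    rw [← hX, real_inner_comm, Quaternion.inner_def] at h
    simp [imQuat_apply] at h
    rw [real_inner_comm, PiLp.inner_apply]; simp
    rw [Fin.sum_univ_three]; linarith
  -- first component
  have hA : ContDiffAt ℝ n (fun w => logVec (su2Quat (anchorMap ωC ωN ωX C₀ N₀ w).1)) w := by
    have heq : (fun w => logVec (su2Quat (anchorMap ωC ωN ωX C₀ N₀ w).1)) = fun w => logVec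
        (exp (imQuat w.1) * (exp (imQuat ((w.2 0) • ωC)) * imQuat ωC) * star (exp (imQuat w.1))) := by
      funext w; rw [su2Quat_anchorMap_fst hC₀]
    rw [heq]
    refine ContDiffAt.comp w (contDiffAt_logVec_of_unit ?_ ?_) contDiff_anchor_fst_quat.contDiffAt
    · rw [← su2Quat_anchorMap_fst (ωN := ωN) (ωX := ωX) (N₀ := N₀) hC₀]; exact norm_su2Quat _
    · rw [← su2Quat_anchorMap_fst (ωN := ωN) (ωX := ωX) (N₀ := N₀) hC₀, re_anchor_fst hC hC₀, abs_neg]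
      have hsin : |Real.sin (w.2 0)| ≤ |w.2 0| := by
        rcases eq_or_ne (w.2 0) 0 with h | h
        · simp [h]
        · exact (Real.abs_sin_lt_abs h).le
      calc |Real.sin (w.2 0)| ≤ |w.2 0| := hsin
        _ ≤ ‖w.2‖ := by simpa using PiLp.norm_apply_le w.2 0
        _ < 1 := hw
  -- second component
  have hB : ContDiffAt ℝ n (fun w => logVec (su2Quat (anchorMap ωC ωN ωX C₀ N₀ w).2)) w := by
    have heq : (fun w => logVec (su2Quat (anchorMap ωC ωN ωX C₀ N₀ w).2)) = fun w => logVec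
        (exp (imQuat w.1) * (exp (imQuat ((w.2 1) • ωN + (w.2 2) • ωX)) * su2Quat N₀) * star (exp (imQuat w.1))) := by
      funext w; rw [su2Quat_anchorMap_snd]
    rw [heq]
    refine ContDiffAt.comp w (contDiffAt_logVec_of_unit ?_ ?_) contDiff_anchor_snd_quat.contDiffAt
    · rw [← su2Quat_anchorMap_snd (ωC := ωC) (C₀ := C₀)]; exact norm_su2Quat _
    · rw [← su2Quat_anchorMap_snd (ωC := ωC) (C₀ := C₀), re_anchor_snd hC hN hCN hX hN₀, abs_mul]
      have hs : |Real.sinc ‖(w.2 1) • ωN + (w.2 2) • ωX‖| ≤ 1 := Real.abs_sinc_le_one _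
      have h1 : |w.2 1| < 1 := lt_of_le_of_lt (by simpa using PiLp.norm_apply_le w.2 1) hw
      calc |Real.sinc ‖(w.2 1) • ωN + (w.2 2) • ωX‖| * |w.2 1| ≤ 1 * |w.2 1| :=
            mul_le_mul_of_nonneg_right hs (abs_nonneg _)
        _ < 1 := by rw [one_mul]; exact h1
  exact hA.prodMk hB

/-! ## §2 The base point -/

/-- `anchorMap(0) = (C₀, N₀)`. [folklore] -/
theorem anchorMap_zero : anchorMap ωC ωN ωX C₀ N₀ 0 = (C₀, N₀) := by
  simp [anchorMap, seamSlice, linkSlice, expPoint_zero]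

/-- `logVec (ι ω) = (π/2)·ω` for a unit vector `ω`. [folklore] -/
theorem logVec_imQuat_unit {ω : EuclideanSpace ℝ (Fin 3)} (hω : ‖ω‖ = 1) : logVec (imQuat ω) = (Real.pi / 2) • ω := by
  have him : imVec (imQuat ω) = ω := imVec_imQuat ω
  have hne : imVec (imQuat ω) ≠ 0 := by
    rw [him]; intro h; rw [h, norm_zero] at hω; exact zero_ne_one hω
  rw [logVec, if_neg hne, him, imQuat_re, Real.arccos_zero, hω, div_one]

/-- `anchorCoord(0) = ((π/2)ω_C, logVec(su2Quat N₀))` with the second entry `±(π/2)ω_N`. [folklore] -/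
theorem anchorCoord_zero (hC : ‖ωC‖ = 1) (hC₀ : su2Quat C₀ = imQuat ωC) :
    anchorCoord ωC ωN ωX C₀ N₀ 0 = ((Real.pi / 2) • ωC, logVec (su2Quat N₀)) := by
  rw [anchorCoord, anchorMap_zero, hC₀, logVec_imQuat_unit hC]


end Anchors

end Summit.QuantumFields.YangMills.Theorems.VirialFluxGap.AnchorSlice

end
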